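import Summits.QuantumFields.YangMills.Theorems.BalabanUVNodesN27SpineGivenEndpointR13SepCoPHSpineReadingOfRecordVCutFSC
import Summits.QuantumFields.YangMills.Theorems.BalabanUVNodesN21ShellSplitOfRecord13CoPHChartKeyedGuarded

/-!
# K3⁷ · THE CHART ROAD REACHES THE ITEM: `Theses.BalabanUVNodes.SpineGivenEndpointR13SepCoPH` in v4∕v5's `PinnedAtLive jc sh cr` shape with the N21 face ON THE LIVE LINE
# supplied by the exponential-`SU(2)`-block-chart road (p608096 `shellWeightBound_guarded₁₃CoPH_of_chartLaws` at `sh := shellSplitOfRecord₁₃At 2 K₀ ρA ρB`) — dag-n27-c's leaf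
# HC4L `spineGivenEndpointR13SepCoPH_of_liveCrOfRecord₁₃VAt_cut_offLiveOneTerm_keyedFacesP_fsc` (p601691 §2) with its `h21` binder DISCHARGED modulo the chart road's per-fibre letters

Track A of `YM-PLAN.md` (cell `pub-ymgap`, HUMAN RULING D-0062 ∕ D-0149 width seats), node **N21** → composite N27; WIDTH SEAT `pub-ymgap-dag-n21-w2` (gen 2), file 15 — the twin, for the
CHART road at the v4∕v5 keys, of my gen-0 leaves E∕F (`…N27SpineGivenEndpointR13SepCoPHDilationRoad[AtReading]`, dilation road, v3 keys).  THEOREMS ONLY: 0 `def`, 0 `sorry`; COUNT-NEUTRAL;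
`--kind proof --supports stmt-QuantumFields-20544 --as helper`; a route-facing leaf, nothing may import it.  Imports dag-n27-c's HC4L (→ UC4, dag-n19-w3's FSC composer, dag-n20-w1's
one-term reading, Theses) and my p608096.  Restates nothing; the composer is CONSUMED BY NAME (ONE application), nothing of dag-n27-c's retyped.

WHAT IS PROVED ([bookkeeping]; ONE application).  ★★ `spineGivenEndpointR13SepCoPH_of_chartRoad_cut_offLiveOneTerm_fsc`: THE ITEM from HC4L's displayed hypotheses with `sh :=
shellSplitOfRecord₁₃At 2 K₀ ρA ρB` (dag-n21-d g9's split of record) — `hrates` (v4∕v5 `KeyedRatesHolderD4`-shape, FSC key), `hζm` (H-ζ) on the live guard, `h20` (N20's keyed witness),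
`h19` (N19′'s FSC-keyed core edge on the cores `weight − shell OF RECORD`), `htarget` (off-live: node U5's Target row at dag-n20-w1's one-term reading) — EXCEPT `h21`, which is REPLACED
by the chart road's per-tuple data on the live guard: `hchart : ∀ F θ hP, (guard ∧ LiveSel) → Admissible → ∀ g₀ os, ∃ DA DB, widths' signs ∧ 0 ≤ D_K ∧ Σ D_K ρ_K < ∞ ∧ the two per-fibre
families of chart-data packages (p605800 §2)`; inside, `E := EOfRecord₁₃ F 2 θ.toStage13Params` and `hsel :=` the guard's live conjunct, (H-U) ∕ `0 ≤ ζ` by the tree's theorems (p608096).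

HONEST FRAMING.  NOT a discharge: a term of the item's type under displayed hypotheses (audit `proof.conditional`), every one inhabited for no family today (K0⁷ OPEN); the chart data
are located letters (window factorisation of the dressed fibre density, density presentation, reading identity, cut-chart-law (M1) — NOT PRINTED, NOT proved); the rates, N20's
witness, N19′'s edge, the Target are HYPOTHESES; `jc`, `ρA`, `ρB`, `K₀` free; nothing of Bałaban's asserted or instantiated; NE7c NOT proved; N21 ∕ N27 NOT discharged; K3⁷ NOT claimed,
skeleton v5 UNTOUCHED; counts UNMOVED (typed 28∕28 · discharged 5∕27); one finite four-torus programme at fixed `ε` — NOT ℝ⁴, NOT infinite volume, NOT OS, NOT a mass gap, NOT Clay.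
-/

set_option autoImplicit false

namespace Summit.QuantumFields.YangMills.Theorems.BalabanUVNodesN27SpineRecord

open scoped BigOperators ENNReal
open MeasureTheory Metric
open Literature.MathematicalPhysics.QuantumFieldTheory.Balaban1983to89
open Literature.MathematicalPhysics.QuantumFieldTheory.Balaban1983to89.T4Continuum
open Literature.MathematicalPhysics.QuantumFieldTheory.Balaban1983to89.Node00 hiding dimSU
open T4WeightBudget (RelWeightBound)
open T4IndicatorShell (ShellWeightBound)
open T4ShellMeasure (SlotAntiConcentration)
open T4ShellMeasureDet (blockLaw)
open T4ContinuumYM4Torus (ForSmallCouplings)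
open Summit.QuantumFields.BalabanUV.T4Continuum.Spine
open NE7 (Target)
open Summit.QuantumFields.YangMills.Theses.BalabanUVNodes (SpineGivenEndpointR13SepCoPH)
open YMDAG.UVSplit hiding SU
open Summit.QuantumFields.YangMills.Theorems.N21ShellSplitOfRecord13CoPH (WidthLetter₁₃CoPH shellSplitOfRecord₁₃At cubeStat inputBlock blockReading blockFibreLawOfDatum₉)
open Summit.QuantumFields.YangMills.Theorems.N21ChartJunctionKeyed (shellWeightBound_guarded₁₃CoPH_of_chartLaws)
open Summit.QuantumFields.BalabanUV.T4Continuum.ShellMeasureExpChartSUN (SUN BlockChartSU expFibreChartSU chartWeightSU)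
open Summit.QuantumFields.BalabanUV.T4Continuum.ShellMeasureScalingSUN (windowSU)
open Summit.QuantumFields.BalabanUV.T4Continuum.ShellMeasureExpJacobianSUN (expJacWeightSU)
open Summit.QuantumFields.BalabanUV.T4Continuum.ShellMeasureExpHaarAreaSUN (kappaSU)

variable (K₀ : ℕ) (jc : (F : T4Family) → (θ : Stage13HParams F 2) → θ.Provisos₁₃CoPH F 2 → (ℕ → ℝ) → List (ULoop F) → ℕ → ℕ)
  (ρA ρB : WidthLetter₁₃CoPH 2)
  (rr : (F : T4Family) → (θ : Stage13HParams F 2) → θ.Provisos₁₃CoPH F 2 → (ℕ → ℝ) → List (ULoop F) → RateCarriers 2)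
  (P : ∀ {F : T4Family}, Datum F 2 → RateCarriers 2 → Prop)

/-- ★★ **THE ITEM, WITH THE N21 FACE ON THE LIVE LINE FROM THE CHART ROAD.**  dag-n27-c's HC4L with `sh := shellSplitOfRecord₁₃At 2 K₀ ρA ρB` and `h21 :=
⟨_, shellWeightBound_guarded₁₃CoPH_of_chartLaws K₀ jc ρA ρB (guard ∧ LiveSel) …⟩` — the chart road's `ShellWeightBound` at `crOfRecord₁₃VAt K₀ (jc F θ hP g₀ os) sh`, whose carriers
ARE HC4L's `(1, classSet₁₃, weightA₁₃, weightB₁₃, sh.1, sh.2)` (n20-d's `rfl` dictionary) and whose weight is the canonical `wshInf`.  Displayed, besides HC4L's `hrates hζm h20 h19 htarget`: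
`hchart` = per live-guarded admissible tuple, `∃ DA DB`, the widths' signs, `0 ≤ D_K`, `Σ_K D_K ρ_K < ∞` and the two per-fibre chart-data families of p605800 §2.  NOT a discharge. [bookkeeping] -/
theorem spineGivenEndpointR13SepCoPH_of_chartRoad_cut_offLiveOneTerm_fsc
    (hrates : ∀ (F : T4Family) (θ : Stage13HParams F 2) (hP : θ.Provisos₁₃CoPH F 2), (θ.ZhUnity F 2 ∧ θ.SlotsNondegenerate₁₃ F 2) → θ.Admissible F 2 →
      B16.EndStatementBPrinted (datumOfRecord₁₃CoPH F 2 θ hP).C → DagBinding.EndpointExistence (datumOfRecord₁₃CoPH F 2 θ hP).C.toB12 →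
        ForSmallCouplings (datumOfRecord₁₃CoPH F 2 θ hP) fun g₀ => ∀ os : List (ULoop F), P (datumOfRecord₁₃CoPH F 2 θ hP) (rr F θ hP g₀ os))
    (hζm : ∀ (F : T4Family) (θ : Stage13HParams F 2), θ.Provisos₁₃CoPH F 2 → ((θ.ZhUnity F 2 ∧ θ.SlotsNondegenerate₁₃ F 2) ∧ θ.ppSel = ppSelLiveOfRecord F 2 θ.ν θ.τ9 (EOfRecord₁₃ F 2 θ.toStage13Params) (wOfRecord₉ F 2 θ.toStage9Params)) → θ.Admissible F 2 → ZetaMeasurable F 2 θ.ζ)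
    (h20 : ∀ (F : T4Family) (θ : Stage13HParams F 2) (hP : θ.Provisos₁₃CoPH F 2), ((θ.ZhUnity F 2 ∧ θ.SlotsNondegenerate₁₃ F 2) ∧ θ.ppSel = ppSelLiveOfRecord F 2 θ.ν θ.τ9 (EOfRecord₁₃ F 2 θ.toStage13Params) (wOfRecord₉ F 2 θ.toStage9Params)) → θ.Admissible F 2 → ∀ (g₀ : ℕ → ℝ) (os : List (ULoop F)),
      ∃ W : ℕ → ℝ, RelWeightBound 1 (classSet₁₃ θ K₀ g₀) (weightA₁₃ θ hP K₀ g₀ os) (weightB₁₃ θ hP K₀ g₀ os) (badClass₁₃ θ K₀ g₀ (jc F θ hP g₀ os)) W)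
    (hchart : ∀ (F : T4Family) (θ : Stage13HParams F 2) (hP : θ.Provisos₁₃CoPH F 2), ((θ.ZhUnity F 2 ∧ θ.SlotsNondegenerate₁₃ F 2) ∧ θ.ppSel = ppSelLiveOfRecord F 2 θ.ν θ.τ9 (EOfRecord₁₃ F 2 θ.toStage13Params) (wOfRecord₉ F 2 θ.toStage9Params)) → θ.Admissible F 2 →
      ∀ (g₀ : ℕ → ℝ) (os : List (ULoop F)),
      ∃ (DA DB : ℕ → ℝ),
        (∀ K, 0 ≤ ρA F θ hP g₀ os K) ∧ (∀ K, 0 ≤ DA K) ∧ (∀ K, 0 ≤ ρB F θ hP g₀ os K) ∧ (∀ K, 0 ≤ DB K) ∧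
        Summable (fun K => DA K * ρA F θ hP g₀ os K) ∧ Summable (fun K => DB K * ρB F θ hP g₀ os K) ∧
        (∀ (K : ℕ) (t : ℝ), |t| ≤ 1 →
          ∀ (a : ↥(cubeIndices (F.P (K₀ + K)) (cubeSide (F.P (K₀ + K)).L θ.ν.M₂ (RkOfRecord (F.P (K₀ + K)).L θ.ν.r (histA₁₃ θ K₀ g₀ K (K₀ + K))) (K₀ + K))))
            (x : GaugeField (F.P (K₀ + K)) (K₀ + K) (SU 2)),
            ∃ (S : ℝ) (c : GaugeField (F.P (K₀ + K)) (K₀ + K) (SU 2)) (R : (↥(inputBlock F θ.ν (histA₁₃ θ K₀ g₀ K) a) → SU 2) → ℝ≥0∞)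
              (U : BlockChartSU 2 (inputBlock F θ.ν (histA₁₃ θ K₀ g₀ K) a) → ℝ) (A : Set (BlockChartSU 2 (inputBlock F θ.ν (histA₁₃ θ K₀ g₀ K) a)))
              (f : BlockChartSU 2 (inputBlock F θ.ν (histA₁₃ θ K₀ g₀ K) a) → ℝ≥0∞) (D : ℝ),
              0 ≤ S ∧ S ≤ Real.pi ∧ Measurable R ∧
              blockFibreLawOfDatum₉ F 2 θ.toStage9Params (datumOfRecord₁₃CoPH F 2 θ hP) g₀ os (runA₁₃ F K₀ g₀ K) (histA₁₃ θ K₀ g₀ K) (K₀ + K) t a (inputBlock F θ.ν (histA₁₃ θ K₀ g₀ K) a) x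
                = (blockLaw (inputBlock F θ.ν (histA₁₃ θ K₀ g₀ K) a)).withDensity (fun y => windowSU (inputBlock F θ.ν (histA₁₃ θ K₀ g₀ K) a) c S y * R y) ∧
              MeasurableSet A ∧
              (∀ z ∈ closedBall (0 : BlockChartSU 2 (inputBlock F θ.ν (histA₁₃ θ K₀ g₀ K) a)) S,
                blockReading 2 (cubeStat F 2 θ.ν (histA₁₃ θ K₀ g₀ K) (Kc := K₀ + K) (k := K₀ + K) a) (inputBlock F θ.ν (histA₁₃ θ K₀ g₀ K) a) (fun _ => 1) (expFibreChartSU (inputBlock F θ.ν (histA₁₃ θ K₀ g₀ K) a) c z) = U z) ∧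
              ((fun z : BlockChartSU 2 (inputBlock F θ.ν (histA₁₃ θ K₀ g₀ K) a) =>
                  chartWeightSU (inputBlock F θ.ν (histA₁₃ θ K₀ g₀ K) a) S (expJacWeightSU (kappaSU 2)) z * R (expFibreChartSU (inputBlock F θ.ν (histA₁₃ θ K₀ g₀ K) a) c z))
                =ᵐ[volume] A.indicator f) ∧
              SlotAntiConcentration (((volume : Measure (BlockChartSU 2 (inputBlock F θ.ν (histA₁₃ θ K₀ g₀ K) a))).withDensity f).restrict A) U
                (epsOfRecord θ.ν (histA₁₃ θ K₀ g₀ K) (K₀ + K)) (ρA F θ hP g₀ os K) D ∧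
              D ≤ DA K) ∧
        (∀ (K : ℕ) (t : ℝ), |t| ≤ 1 →
          ∀ (a : ↥(cubeIndices (F.P (K₀ + K + 1)) (cubeSide (F.P (K₀ + K + 1)).L θ.ν.M₂ (RkOfRecord (F.P (K₀ + K + 1)).L θ.ν.r (histB₁₃ θ K₀ g₀ K (K₀ + K + 1))) (K₀ + K + 1))))
            (x : GaugeField (F.P (K₀ + K + 1)) (K₀ + K + 1) (SU 2)),
            ∃ (S : ℝ) (c : GaugeField (F.P (K₀ + K + 1)) (K₀ + K + 1) (SU 2)) (R : (↥(inputBlock F θ.ν (histB₁₃ θ K₀ g₀ K) a) → SU 2) → ℝ≥0∞)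
              (U : BlockChartSU 2 (inputBlock F θ.ν (histB₁₃ θ K₀ g₀ K) a) → ℝ) (A : Set (BlockChartSU 2 (inputBlock F θ.ν (histB₁₃ θ K₀ g₀ K) a)))
              (f : BlockChartSU 2 (inputBlock F θ.ν (histB₁₃ θ K₀ g₀ K) a) → ℝ≥0∞) (D : ℝ),
              0 ≤ S ∧ S ≤ Real.pi ∧ Measurable R ∧
              blockFibreLawOfDatum₉ F 2 θ.toStage9Params (datumOfRecord₁₃CoPH F 2 θ hP) g₀ os (runB₁₃ F K₀ g₀ K) (histB₁₃ θ K₀ g₀ K) (K₀ + K + 1) t a (inputBlock F θ.ν (histB₁₃ θ K₀ g₀ K) a) x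
                = (blockLaw (inputBlock F θ.ν (histB₁₃ θ K₀ g₀ K) a)).withDensity (fun y => windowSU (inputBlock F θ.ν (histB₁₃ θ K₀ g₀ K) a) c S y * R y) ∧
              MeasurableSet A ∧
              (∀ z ∈ closedBall (0 : BlockChartSU 2 (inputBlock F θ.ν (histB₁₃ θ K₀ g₀ K) a)) S,
                blockReading 2 (cubeStat F 2 θ.ν (histB₁₃ θ K₀ g₀ K) (Kc := K₀ + K + 1) (k := K₀ + K + 1) a) (inputBlock F θ.ν (histB₁₃ θ K₀ g₀ K) a) (fun _ => 1) (expFibreChartSU (inputBlock F θ.ν (histB₁₃ θ K₀ g₀ K) a) c z) = U z) ∧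
              ((fun z : BlockChartSU 2 (inputBlock F θ.ν (histB₁₃ θ K₀ g₀ K) a) =>
                  chartWeightSU (inputBlock F θ.ν (histB₁₃ θ K₀ g₀ K) a) S (expJacWeightSU (kappaSU 2)) z * R (expFibreChartSU (inputBlock F θ.ν (histB₁₃ θ K₀ g₀ K) a) c z))
                =ᵐ[volume] A.indicator f) ∧
              SlotAntiConcentration (((volume : Measure (BlockChartSU 2 (inputBlock F θ.ν (histB₁₃ θ K₀ g₀ K) a))).withDensity f).restrict A) U
                (epsOfRecord θ.ν (histB₁₃ θ K₀ g₀ K) (K₀ + K + 1)) (ρB F θ hP g₀ os K) D ∧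
              D ≤ DB K))
    (h19 : ∀ (F : T4Family) (θ : Stage13HParams F 2) (hP : θ.Provisos₁₃CoPH F 2), ((θ.ZhUnity F 2 ∧ θ.SlotsNondegenerate₁₃ F 2) ∧ θ.ppSel = ppSelLiveOfRecord F 2 θ.ν θ.τ9 (EOfRecord₁₃ F 2 θ.toStage13Params) (wOfRecord₉ F 2 θ.toStage9Params)) → θ.Admissible F 2 →
      B16.EndStatementBPrinted (datumOfRecord₁₃CoPH F 2 θ hP).C → DagBinding.EndpointExistence (datumOfRecord₁₃CoPH F 2 θ hP).C.toB12 →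
        ForSmallCouplings (datumOfRecord₁₃CoPH F 2 θ hP) fun g₀ => ∀ os : List (ULoop F),
          P (datumOfRecord₁₃CoPH F 2 θ hP) (rr F θ hP g₀ os) → letI : DecidableEq (Σ K, SiteSeqKey F (K₀ + K)) := Classical.decEq _
            ∃ δ : ℕ → ℝ, NE7.Core 1 (F.side ^ 4) (classSet₁₃ θ K₀ g₀) (badClass₁₃ θ K₀ g₀ (jc F θ hP g₀ os))
              (fun K t x => weightA₁₃ θ hP K₀ g₀ os K t x - (shellSplitOfRecord₁₃At 2 K₀ ρA ρB F θ hP g₀ os).1 K t x)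
              (fun K t x => weightB₁₃ θ hP K₀ g₀ os K t x - (shellSplitOfRecord₁₃At 2 K₀ ρA ρB F θ hP g₀ os).2 K t x) δ ∧ Summable δ)
    (htarget : ∀ (F : T4Family) (θ : Stage13HParams F 2) (hP : θ.Provisos₁₃CoPH F 2), ((θ.ZhUnity F 2 ∧ θ.SlotsNondegenerate₁₃ F 2) ∧ ¬ θ.ppSel = ppSelLiveOfRecord F 2 θ.ν θ.τ9 (EOfRecord₁₃ F 2 θ.toStage13Params) (wOfRecord₉ F 2 θ.toStage9Params)) → θ.Admissible F 2 →
      B16.EndStatementBPrinted (datumOfRecord₁₃CoPH F 2 θ hP).C → DagBinding.EndpointExistence (datumOfRecord₁₃CoPH F 2 θ hP).C.toB12 →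
        ForSmallCouplings (datumOfRecord₁₃CoPH F 2 θ hP) fun g₀ => ∀ os : List (ULoop F), P (datumOfRecord₁₃CoPH F 2 θ hP) (rr F θ hP g₀ os) →
          ∃ δ : ℕ → ℝ, Target ((F.side : ℝ) ^ 4) 1 δ (fun K => T4GenFunBounds.schemeZ ((datumOfRecord₁₃CoPH F 2 θ hP).scheme g₀) os (K₀ + K))) :
    SpineGivenEndpointR13SepCoPH :=
  spineGivenEndpointR13SepCoPH_of_liveCrOfRecord₁₃VAt_cut_offLiveOneTerm_keyedFacesP_fsc K₀ jc (shellSplitOfRecord₁₃At 2 K₀ ρA ρB) rr P hrates hζm h20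
    (fun F θ hP hRg hθ g₀ os =>
      ⟨_, shellWeightBound_guarded₁₃CoPH_of_chartLaws K₀ jc ρA ρB
        (fun F (θ : Stage13HParams F 2) => ((θ.ZhUnity F 2 ∧ θ.SlotsNondegenerate₁₃ F 2) ∧ θ.ppSel = ppSelLiveOfRecord F 2 θ.ν θ.τ9 (EOfRecord₁₃ F 2 θ.toStage13Params) (wOfRecord₉ F 2 θ.toStage9Params)))
        (fun F θ hP hRg hθ g₀ os => by
          obtain ⟨DA, DB, hρA, hDA, hρB, hDB, hsA, hsB, hA, hB⟩ := hchart F θ hP hRg hθ g₀ os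
          exact ⟨EOfRecord₁₃ F 2 θ.toStage13Params, DA, DB, hRg.2, hζm F θ hP hRg hθ, hρA, hDA, hρB, hDB, hsA, hsB, hA, hB⟩)
        F θ hP hRg hθ g₀ os⟩)
    h19 htarget

end Summit.QuantumFields.YangMills.Theorems.BalabanUVNodesN27SpineRecord
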